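import Summits.ResolutionOfSingularities.ResolutionOfSingularities.Theorems.PurelyInseparableDim4ResConeCInfLayerSigma
import Summits.ResolutionOfSingularities.ResolutionOfSingularities.Theorems.PurelyInseparableDim4ResConeCInfLayerStepSigma
import HarnessLib
import HarnessLib.Audit.Tags

/-!
# Purely inseparable four-folds — ENTRY♯ CORE of the flagless branch, every σ = (n, n) + 0 and every prime: from a σ-flagless letter change
# to REGIME R in two translated slot steps, and the propagation of (σ-ledger, regime R, LAYER) through one more step — the `1 ↦ n` edition of
# FILE ♯8-core `…ResConeCInfSharpEntryCorePrime` WITHOUT the ♯-flag conjuncts (cell `res-dim4-pi`, K2(p) lane, class (iii) rows σ = (n, n) + 0,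
# flagless branch, FILE ♯8-coreσ)

[OURS · counted 0 · cell `res-dim4-pi` · K2(p) lane (holder res-dim4-p-12 g5, ruling g5-33 «(σ♭)»; res-dim4-p-3 g6's MEMO
`res-dim4-p-3/MEMO-g6-FLAGLESS-SHARP.md` §2–§3, §6 ♯8 and σ-allocation (bus 2026-08-29 16:00Z: «START only; the propagation of the ♯-flag is
not needed since d ≤ 5 kills at regime R»); conventions of res-dim4-typ-1 g6 (bus 15:49Z); typed by the width seat res-dim4-p-13 g6 by
signature).]  Nothing here proves K2(p) for any `p`, any TAIL(p, d, 3), FLAGLESS♯, `NoIsolatedTrap p p`, the Cossart–Jannsen–Saito theorem or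
resolution of singularities in dimension ≥ 4 / characteristic `p` — NOT proved.  AI kernel work, weaker than expert review.  Exponent algebra
about OUR frame; it kills nothing by itself.

SETTING.  Twin slots `j, i` of weight `n ≥ 1`, free letter `u`, contact letter `f`; `n + d = p`, `2 ≤ d`; F-exponents `(e_j, e_i, e_u, e_f)`;
«in regime» for a state = every monomial has degree `≥ p + n + 1` or is the cone `x_j^n x_i^n x_f^d` (order `p + n`, straight, in support
form); SLOTS «`e_j, e_i ≥ n`» (`x^r ∣ F`, `r = n·j + n·i`); σ-LEDGER «`e_f ≤ d − 1 ⇒ e_j, e_i ≥ n + 1`»; REGIME R «`e_f + 2 ≤ d ⇒ e_j, e_i ≥ n + 2`»;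
LAYER «no monomial of degree `p + n + 1` with `e_f + 2 ≤ d`»; σ-FLAG rows `x_j^{n+1} x_i^{n+1} x_u^{d−1−c} x_f^c` (`c + 2 ≤ d`); σ-`κ`-KILLERS
`x_j^{a} x_i^{n+1} x_u^{d+n−c−a} x_f^{c}` (`n + 2 ≤ a ≤ d + n − c`, `c + 2 ≤ d`).  The steps are slot steps translated along `u`.  For `n = 1`
(`d + 1 = p`) every statement below is literally the corresponding statement of FILE ♯8-core (minus the ♯-flag conjuncts of its §1).
* §1 **`sharpEntry_step_sigma`** — PROPAGATION: parent in regime with SLOTS, σ-LEDGER, REGIME R and LAYER; child `κ(β)`; grandchild (either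
  slot, any `β′`) in regime ⇒ the CHILD has SLOTS, σ-LEDGER, REGIME R and LAYER (♯2bσ — the killer hypothesis of `layer_step_change_sigma` is
  discharged by regime R: a σ-killer has `e_i = n + 1`).  Mirror for `o(β)` by `j ↔ i`.
* §2 **`sharpEntry_start_sigma`** — START: parent in regime with SLOTS, σ-LEDGER and σ-FLAGLESS; `S₁ = κ(β₀)` in regime and free of
  σ-`κ`-KILLERS; `S₂ = o(β₁) S₁` in regime; `S₃` = a further slot step of `S₂` in regime ⇒ `S₂` has SLOTS, σ-LEDGER, REGIME R and LAYER
  (♯2σ `letterChange_layer_sigma` at the parent, ♯2bσ twice, ♯1σ `coeff_flag_step_translate_u_sigma` for the flag of `S₁`).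
[cite: Hauser2010, §§F–G] [cite: CossartJannsenSaito2020, Thm. 3.14]
bears_on: LADDER-RESOLUTION:D157-DOOR2 (res-dim4-pi · K2(p) · power cones · class (iii) σ = (n,n)+0 flagless branch ♯8-coreσ).  Supports
stmt-ResolutionOfSingularities-16155 (helper).
-/

set_option linter.dupNamespace false -- mandated namespace of this single-conjunct summit

noncomputable section

namespace Summit.ResolutionOfSingularities.ResolutionOfSingularities.Theorems.PIDim4

namespace ResCone

open MvPolynomial Finset
open Literature.AlgebraicGeometry.Resolution
open Literature.AlgebraicGeometry.Resolution.CentreBlowup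
open Literature.AlgebraicGeometry.Resolution.Hauser2010
open Literature.AlgebraicGeometry.Resolution.HauserPerlega2019

variable {K : Type} [Field K] [DecidableEq K]

section Step

variable {j i u f : Fin 4} (hji : j ≠ i) (hju : j ≠ u) (hjf : j ≠ f) (hiu : i ≠ u) (hif : i ≠ f) (huf : u ≠ f)
include hji hju hjf hiu hif huf

omit [DecidableEq K] in
/-- «In regime» in support form (σ-edition) implies the order / straightness hypotheses of the σ-♯-lemmas. [OURS · bookkeeping] -/
theorem h6_straight_of_reg_sigma {p n d : ℕ} (hσ : n + d = p) {F : MvPolynomial (Fin 4) K}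
    (hreg : ∀ E ∈ F.support, p + n + 1 ≤ E.degree ∨
      E = Finsupp.single j n + Finsupp.single i n + Finsupp.single u 0 + Finsupp.single f d) :
    (∀ e ∈ F.support, p + n ≤ e.degree) ∧
      (∀ e ∈ F.support, e.degree = p + n →
        e = Finsupp.single j n + Finsupp.single i n + Finsupp.single u 0 + Finsupp.single f d) := by
  have hdeg : (Finsupp.single j n + Finsupp.single i n + Finsupp.single u 0 + Finsupp.single f d : Fin 4 →₀ ℕ).degree = p + n := by
    rw [degree_eq_quad hji hju hjf hiu hif huf]
    obtain ⟨h1, h2, h3, h4⟩ := quad_apply hji hju hjf hiu hif huf n n 0 d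
    rw [h1, h2, h3, h4]; omega
  refine ⟨fun e he => ?_, fun e he hd => ?_⟩
  · rcases hreg e he with h | h
    · omega
    · rw [h, hdeg]
  · rcases hreg e he with h | h
    · omega
    · exact h

/-! ## 1. Propagation of (SLOTS, σ-LEDGER, REGIME R, LAYER) through one slot step -/

/-- **σ-♯-FRAME PROPAGATION, chart `j`** (`n + d = p`, `2 ≤ d`; module docstring §1). The `n = 1` case is the first four conjuncts of FILE
♯8-core's `sharpEntry_step_prime`. [OURS] [cite: Hauser2010, §§F–G] -/
theorem sharpEntry_step_sigma (p : ℕ) {n d : ℕ} (hσ : n + d = p) (hd2 : 2 ≤ d) (s : State K)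
    (hq : ((p : ℕ) : ℕ∞) ≤ ordAlong Finset.univ s.F) (hr1 : ∀ e ∈ s.F.support, n ≤ e j ∧ n ≤ e i)
    (hreg : ∀ E ∈ s.F.support, p + n + 1 ≤ E.degree ∨
      E = Finsupp.single j n + Finsupp.single i n + Finsupp.single u 0 + Finsupp.single f d)
    (hled : ∀ e ∈ s.F.support, e f ≤ d - 1 → n + 1 ≤ e j ∧ n + 1 ≤ e i)
    (hR : ∀ e ∈ s.F.support, e f + 2 ≤ d → n + 2 ≤ e j ∧ n + 2 ≤ e i)
    (hlayer : ∀ E : Fin 4 →₀ ℕ, E.degree = p + n + 1 → E f + 2 ≤ d → coeff E s.F = 0) (β : K)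
    (hq₁ : ((p : ℕ) : ℕ∞) ≤ ordAlong Finset.univ (CentreBlowup.step p Finset.univ j (Function.update (0 : Fin 4 → K) u β) s).F)
    {ℓ : Fin 4} (hℓ : ℓ = j ∨ ℓ = i) (β' : K)
    (hreg₂ : ∀ E ∈ (CentreBlowup.step p Finset.univ ℓ (Function.update (0 : Fin 4 → K) u β')
        (CentreBlowup.step p Finset.univ j (Function.update (0 : Fin 4 → K) u β) s)).F.support,
      p + n + 1 ≤ E.degree ∨ E = Finsupp.single j n + Finsupp.single i n + Finsupp.single u 0 + Finsupp.single f d) :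
    (∀ e ∈ (CentreBlowup.step p Finset.univ j (Function.update (0 : Fin 4 → K) u β) s).F.support, n ≤ e j ∧ n ≤ e i) ∧
      (∀ e ∈ (CentreBlowup.step p Finset.univ j (Function.update (0 : Fin 4 → K) u β) s).F.support,
        e f ≤ d - 1 → n + 1 ≤ e j ∧ n + 1 ≤ e i) ∧
      (∀ e ∈ (CentreBlowup.step p Finset.univ j (Function.update (0 : Fin 4 → K) u β) s).F.support,
        e f + 2 ≤ d → n + 2 ≤ e j ∧ n + 2 ≤ e i) ∧
      (∀ E : Fin 4 →₀ ℕ, E.degree = p + n + 1 → E f + 2 ≤ d →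
        coeff E (CentreBlowup.step p Finset.univ j (Function.update (0 : Fin 4 → K) u β) s).F = 0) := by
  obtain ⟨h6, hstraight⟩ := h6_straight_of_reg_sigma hji hju hjf hiu hif huf hσ hreg
  obtain ⟨hled₁, -⟩ := ledger_degree_step_translate_u_sigma hji hju hjf hiu hif huf p hd2 s hq h6 hstraight hled β
  have h3j := le_apply_of_layer_step_translate_u_sigma hji hju hjf hiu hif huf p s hq h6 hstraight hlayer β
  have h3i := le_apply_of_step_translate_other hji.symm hiu hif hju hjf huf p (d := d) (n := n + 2) s hq
    (fun E hE hEf => (hR E hE hEf).2) β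
  have hR₁ : ∀ e ∈ (CentreBlowup.step p Finset.univ j (Function.update (0 : Fin 4 → K) u β) s).F.support,
      e f + 2 ≤ d → n + 2 ≤ e j ∧ n + 2 ≤ e i := fun e he hef => ⟨h3j e he hef, h3i e he hef⟩
  -- LAYER of the child: same letter directly, letter change with the killer hypothesis discharged by regime R
  have hlayer₁ : ∀ E : Fin 4 →₀ ℕ, E.degree = p + n + 1 → E f + 2 ≤ d →
      coeff E (CentreBlowup.step p Finset.univ j (Function.update (0 : Fin 4 → K) u β) s).F = 0 := by
    rcases hℓ with rfl | rfl
    · exact layer_step_same_sigma hji hju hjf hiu hif huf p hσ hd2 s hq h6 hstraight hlayer β β' hq₁ hreg₂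
    · refine layer_step_change_sigma hji hju hjf hiu hif huf p hσ hd2 s hq h6 hstraight hled hlayer β β' hq₁ ?_ hreg₂
      intro a c ha hc hac
      by_contra hne
      have hmem := mem_support_iff.mpr hne
      have h3 := (hR₁ _ hmem (by rw [(quad_apply hji hju hjf hiu hif huf a (n + 1) (d + n - c - a) c).2.2.2]; exact hc)).2
      rw [(quad_apply hji hju hjf hiu hif huf a (n + 1) (d + n - c - a) c).2.1] at h3
      omega
  have hr1₁ : ∀ e ∈ (CentreBlowup.step p Finset.univ j (Function.update (0 : Fin 4 → K) u β) s).F.support,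
      n ≤ e j ∧ n ≤ e i := by
    intro E hE
    obtain ⟨δ, hmem, hm, hi, -, -⟩ := exists_parent_of_mem_support_step_translate_u hji hju hjf hiu hif huf p s hq β hE
    have := h6 δ hmem
    exact ⟨by omega, by rw [← hi]; exact (hr1 δ hmem).2⟩
  exact ⟨hr1₁, hled₁, hR₁, hlayer₁⟩

/-! ## 2. From a σ-flagless letter change to regime R -/

/-- **ENTRY♯ START, σ-edition** (`n + d = p`, `2 ≤ d`; module docstring §2): parent `s` in regime with SLOTS, the σ-ledger and NO σ-flag
(`coeff x_j^{n+1} x_i^{n+1} x_u^{d−1−c} x_f^c = 0`, `c + 2 ≤ d`); `S₁ = κ(β₀)` in regime and free of σ-`κ`-killers `x_j^{a} x_i^{n+1} x_u^{d+n−c−a} x_f^c`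
(`n + 2 ≤ a ≤ d + n − c`, `c + 2 ≤ d`); `S₂ = o(β₁) S₁` in regime; `S₃ = ℓ(β₂) S₂` (`ℓ ∈ {κ, o}`) in regime.  THEN `S₂` has SLOTS, the σ-ledger,
REGIME R and LAYER — the hypotheses of `sharpEntry_step_sigma`, which then carries them along the rest of the chain. The `n = 1` case is
FILE ♯8-core's `sharpEntry_start_prime`. [OURS] [cite: Hauser2010, §§F–G] [cite: CossartJannsenSaito2020, Thm. 3.14] -/
theorem sharpEntry_start_sigma (p : ℕ) {n d : ℕ} (hσ : n + d = p) (hd2 : 2 ≤ d) (s : State K)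
    (hq : ((p : ℕ) : ℕ∞) ≤ ordAlong Finset.univ s.F) (hr1 : ∀ e ∈ s.F.support, n ≤ e j ∧ n ≤ e i)
    (hreg : ∀ E ∈ s.F.support, p + n + 1 ≤ E.degree ∨
      E = Finsupp.single j n + Finsupp.single i n + Finsupp.single u 0 + Finsupp.single f d)
    (hled : ∀ e ∈ s.F.support, e f ≤ d - 1 → n + 1 ≤ e j ∧ n + 1 ≤ e i)
    (hflag : ∀ c, c + 2 ≤ d →
      coeff (Finsupp.single j (n + 1) + Finsupp.single i (n + 1) + Finsupp.single u (d - 1 - c) + Finsupp.single f c) s.F = 0)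
    (β₀ : K)
    (hq₁ : ((p : ℕ) : ℕ∞) ≤ ordAlong Finset.univ (CentreBlowup.step p Finset.univ j (Function.update (0 : Fin 4 → K) u β₀) s).F)
    (hreg₁ : ∀ E ∈ (CentreBlowup.step p Finset.univ j (Function.update (0 : Fin 4 → K) u β₀) s).F.support,
      p + n + 1 ≤ E.degree ∨ E = Finsupp.single j n + Finsupp.single i n + Finsupp.single u 0 + Finsupp.single f d)
    (hnokill₁ : ∀ a c : ℕ, n + 2 ≤ a → c + 2 ≤ d → a ≤ d + n - c →
      coeff (Finsupp.single j a + Finsupp.single i (n + 1) + Finsupp.single u (d + n - c - a) + Finsupp.single f c)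
        (CentreBlowup.step p Finset.univ j (Function.update (0 : Fin 4 → K) u β₀) s).F = 0)
    (β₁ : K)
    (hq₂ : ((p : ℕ) : ℕ∞) ≤ ordAlong Finset.univ (CentreBlowup.step p Finset.univ i (Function.update (0 : Fin 4 → K) u β₁)
      (CentreBlowup.step p Finset.univ j (Function.update (0 : Fin 4 → K) u β₀) s)).F)
    (hreg₂ : ∀ E ∈ (CentreBlowup.step p Finset.univ i (Function.update (0 : Fin 4 → K) u β₁)
        (CentreBlowup.step p Finset.univ j (Function.update (0 : Fin 4 → K) u β₀) s)).F.support,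
      p + n + 1 ≤ E.degree ∨ E = Finsupp.single j n + Finsupp.single i n + Finsupp.single u 0 + Finsupp.single f d)
    {ℓ : Fin 4} (hℓ : ℓ = j ∨ ℓ = i) (β₂ : K)
    (hreg₃ : ∀ E ∈ (CentreBlowup.step p Finset.univ ℓ (Function.update (0 : Fin 4 → K) u β₂)
        (CentreBlowup.step p Finset.univ i (Function.update (0 : Fin 4 → K) u β₁)
          (CentreBlowup.step p Finset.univ j (Function.update (0 : Fin 4 → K) u β₀) s))).F.support,
      p + n + 1 ≤ E.degree ∨ E = Finsupp.single j n + Finsupp.single i n + Finsupp.single u 0 + Finsupp.single f d) :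
    (∀ e ∈ (CentreBlowup.step p Finset.univ i (Function.update (0 : Fin 4 → K) u β₁)
        (CentreBlowup.step p Finset.univ j (Function.update (0 : Fin 4 → K) u β₀) s)).F.support, n ≤ e j ∧ n ≤ e i) ∧
      (∀ e ∈ (CentreBlowup.step p Finset.univ i (Function.update (0 : Fin 4 → K) u β₁)
        (CentreBlowup.step p Finset.univ j (Function.update (0 : Fin 4 → K) u β₀) s)).F.support,
        e f ≤ d - 1 → n + 1 ≤ e j ∧ n + 1 ≤ e i) ∧
      (∀ e ∈ (CentreBlowup.step p Finset.univ i (Function.update (0 : Fin 4 → K) u β₁)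
        (CentreBlowup.step p Finset.univ j (Function.update (0 : Fin 4 → K) u β₀) s)).F.support,
        e f + 2 ≤ d → n + 2 ≤ e j ∧ n + 2 ≤ e i) ∧
      (∀ E : Fin 4 →₀ ℕ, E.degree = p + n + 1 → E f + 2 ≤ d →
        coeff E (CentreBlowup.step p Finset.univ i (Function.update (0 : Fin 4 → K) u β₁)
          (CentreBlowup.step p Finset.univ j (Function.update (0 : Fin 4 → K) u β₀) s)).F = 0) := by
  set S₁ := CentreBlowup.step p Finset.univ j (Function.update (0 : Fin 4 → K) u β₀) s with hS₁
  set S₂ := CentreBlowup.step p Finset.univ i (Function.update (0 : Fin 4 → K) u β₁) S₁ with hS₂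
  obtain ⟨h6, hstraight⟩ := h6_straight_of_reg_sigma hji hju hjf hiu hif huf hσ hreg
  obtain ⟨h6₁, hstraight₁⟩ := h6_straight_of_reg_sigma hji hju hjf hiu hif huf hσ hreg₁
  -- the cone written with the slots exchanged, for the mirror lemmas
  have hcone : (Finsupp.single j n + Finsupp.single i n + Finsupp.single u 0 + Finsupp.single f d : Fin 4 →₀ ℕ) =
      Finsupp.single i n + Finsupp.single j n + Finsupp.single u 0 + Finsupp.single f d := gameExp_swap n n 0 d
  have hstraight₁' : ∀ e ∈ S₁.F.support, e.degree = p + n →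
      e = Finsupp.single i n + Finsupp.single j n + Finsupp.single u 0 + Finsupp.single f d := fun e he hd =>
    (hstraight₁ e he hd).trans hcone
  have hreg₃' : ∀ E ∈ (CentreBlowup.step p Finset.univ ℓ (Function.update (0 : Fin 4 → K) u β₂) S₂).F.support,
      p + n + 1 ≤ E.degree ∨ E = Finsupp.single i n + Finsupp.single j n + Finsupp.single u 0 + Finsupp.single f d :=
    fun E hE => (hreg₃ E hE).imp_right fun h => h.trans hcone
  -- the σ-flag of `S₁` is the σ-flag of `s`: zero
  have hflag₁ : ∀ c, c + 2 ≤ d →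
      coeff (Finsupp.single j (n + 1) + Finsupp.single i (n + 1) + Finsupp.single u (d - 1 - c) + Finsupp.single f c) S₁.F = 0 := by
    intro c hc
    rw [hS₁, coeff_flag_step_translate_u_sigma hji hju hjf hiu hif huf p hσ hd2 s hq (fun e he hef => (hled e he hef).1) β₀ hc,
      hflag c hc]
  -- LC: the parent is LAYER; then the κ-child is LAYER
  have hlayer₀ := letterChange_layer_sigma hji hju hjf hiu hif huf p hσ hd2 s hq h6 hstraight hled β₀ β₁ hq₁ hreg₁ hflag₁ hreg₂
  have hlayer₁ := layer_step_change_sigma hji hju hjf hiu hif huf p hσ hd2 s hq h6 hstraight hled hlayer₀ β₀ β₁ hq₁ hnokill₁ hreg₂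
  obtain ⟨hled₁, -⟩ := ledger_degree_step_translate_u_sigma hji hju hjf hiu hif huf p hd2 s hq h6 hstraight hled β₀
  have h3j₁ := le_apply_of_layer_step_translate_u_sigma hji hju hjf hiu hif huf p s hq h6 hstraight hlayer₀ β₀
  -- slot exponents ≥ n survive
  have hr1₁ : ∀ e ∈ S₁.F.support, n ≤ e j ∧ n ≤ e i := by
    intro E hE
    obtain ⟨δ, hmem, hm, hi, -, -⟩ := exists_parent_of_mem_support_step_translate_u hji hju hjf hiu hif huf p s hq β₀ hE
    have := h6 δ hmem
    exact ⟨by omega, by rw [← hi]; exact (hr1 δ hmem).2⟩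
  have hr1₂ : ∀ e ∈ S₂.F.support, n ≤ e j ∧ n ≤ e i := by
    intro E hE
    obtain ⟨δ, hmem, hm, hj, -, -⟩ := exists_parent_of_mem_support_step_translate_u hji.symm hiu hif hju hjf huf p S₁ hq₁ β₁ hE
    have := h6₁ δ hmem
    exact ⟨by rw [← hj]; exact (hr1₁ δ hmem).1, by omega⟩
  -- the o-child S₂: σ-ledger (mirror transport), regime R, LAYER (mirror step lemmas)
  have hled₁' : ∀ e ∈ S₁.F.support, e f ≤ d - 1 → n + 1 ≤ e i ∧ n + 1 ≤ e j := fun e he hef => (hled₁ e he hef).symm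
  obtain ⟨hled₂', -⟩ := ledger_degree_step_translate_u_sigma hji.symm hiu hif hju hjf huf p hd2 S₁ hq₁ h6₁ hstraight₁' hled₁' β₁
  have hled₂ : ∀ e ∈ S₂.F.support, e f ≤ d - 1 → n + 1 ≤ e j ∧ n + 1 ≤ e i := fun e he hef => (hled₂' e he hef).symm
  have h3i₂ := le_apply_of_layer_step_translate_u_sigma hji.symm hiu hif hju hjf huf p S₁ hq₁ h6₁ hstraight₁' hlayer₁ β₁
  have h3j₂ := le_apply_of_step_translate_other hji hju hjf hiu hif huf p (d := d) (n := n + 2) S₁ hq₁ h3j₁ β₁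
  have hR₂ : ∀ e ∈ S₂.F.support, e f + 2 ≤ d → n + 2 ≤ e j ∧ n + 2 ≤ e i := fun e he hef => ⟨h3j₂ e he hef, h3i₂ e he hef⟩
  have hlayer₂ : ∀ E : Fin 4 →₀ ℕ, E.degree = p + n + 1 → E f + 2 ≤ d → coeff E S₂.F = 0 := by
    rcases hℓ with rfl | rfl
    · -- o then κ: mirror letter change; the o-killers have e_j = n + 1, absent since e_j ≥ n + 2 in S₂
      refine layer_step_change_sigma hji.symm hiu hif hju hjf huf p hσ hd2 S₁ hq₁ h6₁ hstraight₁' hled₁' hlayer₁ β₁ β₂ hq₂ ?_ hreg₃'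
      intro a c ha hc hac
      by_contra hne
      have hmem := mem_support_iff.mpr hne
      have h3 := (hR₂ _ hmem (by rw [(quad_apply hji.symm hiu hif hju hjf huf a (n + 1) (d + n - c - a) c).2.2.2]; exact hc)).1
      rw [(quad_apply hji.symm hiu hif hju hjf huf a (n + 1) (d + n - c - a) c).2.1] at h3
      omega
    · exact layer_step_same_sigma hji.symm hiu hif hju hjf huf p hσ hd2 S₁ hq₁ h6₁ hstraight₁' hlayer₁ β₁ β₂ hq₂ hreg₃'
  exact ⟨hr1₂, hled₂, hR₂, hlayer₂⟩

end Step

end ResCone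

end Summit.ResolutionOfSingularities.ResolutionOfSingularities.Theorems.PIDim4
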